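import Mathlib
import HarnessLib
import Literature.Probability.RandomPlanarGeometry.NestingTransform
import Literature.Probability.Percolation.FullPlaneCNL
import Literature.Probability.Percolation.NestingWeightMeasurable
import Literature.Probability.Percolation.SiteNestingWeightIntegrable
import Literature.Probability.Percolation.SiteNestingWeightBound
import Literature.Probability.Percolation.NestingPhaseEstimates
import Literature.Probability.LatticeModels.BesselSaddleComplex
import Summits.CriticalPhenomena.CardyFormulaZ2.Theorems.CardyMagicRigidityMagicFormulaTStubUVSandwich

/-!
# Line `Sketch` (v8) for crux `MagicFormulaT`, stub E `stub_entire`: the fixed-mesh differentiation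
# package of the complex-coupling nesting transform

Crux `Summit.CriticalPhenomena.CardyFormulaZ2.Theses.CardyMagicRigidity.MagicFormulaT`
(stmt-CriticalPhenomena-4836), line `Sketch`, registered skeleton v8, stub `stub_entire`.  For an
admissible density `f` (`|f| ≤ C`, `f = 0` off `B̄(0, R)`, `∫ f = 0`) and a mesh `δ > 0`, the transform
`Φ_δ(t) = E_{1/2}[∏_u 2cos(t·θ_u(f) + π/3)]` (`θ_u(f) = u.nestingPhase f`, loops of `siteLoopConfig δ ω`
under `triSitePercolation half`) is an entire function of `t ∈ ℂ`, `Φ_δ(0) = 1`,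
`Φ_δ'(0) = −√3 · E[Σ_u θ_u(f)]`, and `Φ_δ(t) = truncNestingTransform … (t·f) 0` for real `t`.

Proof.  At fixed mesh at most `N(δ, R)` loops meet `B̄(0, R)` (`ncard_loops_siteLoopConfig_meeting_le`),
only those can have `θ_u ≠ 0` (`sw_meets_of_nestingPhase_ne_zero`), and `2cos(t·0 + π/3) = 1`: for
every `ω` the `finprod` is a `Finset.prod` over a `t`-independent finite family of entire factors, with
`|θ_u| ≤ K = C · Leb(B̄(0,R))` (`abs_nestingPhase_le_mul_volume_closedBall`), so
`‖integrand‖ ≤ (2e^{ρK+2})^N` and `‖∂_t integrand‖ ≤ N (2e^{ρK+2})^{N+1} K` on `‖t‖ ≤ ρ`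
(`‖cos z‖, ‖sin z‖ ≤ e^{|Im z|}`, `BesselInterp.norm_cos_le_exp_abs_im`).  Differentiate under the
integral sign (`hasDerivAt_integral_of_dominated_loc_of_deriv_le`); the integrand is measurable as an
eventually constant limit of finite products of simple functions (complex form of
`measurable_finprod_mem_of_subset_range`), its `t`-derivative as a limit of difference quotients.
At `t = 0`: `2cos(π/3) = 1`, `−2sin(π/3) = −√3`; the real identity is `Complex.ofReal_cos` +
`nestingPhase (t·f) = t · nestingPhase f` + `integral_complex_ofReal`.  No named fact is used; no
definition is introduced.
-/

noncomputable section

namespace Summit.CriticalPhenomena.CardyFormulaZ2.Cruxes.MagicFormulaT.LineSketch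

open MeasureTheory Filter Set Metric
open scoped Real Topology BigOperators ENNReal
open Literature.Probability.RandomPlanarGeometry Literature.Probability.Percolation
  Literature.Probability.LatticeModels

/-! ## Measurability -/

/-- **Measurability of `ω ↦ ∏ᶠ_{a ∈ S ω} g a` for complex `g`** when `S ω ⊆ range U` (`U` on a countable
nonempty index type), membership events are measurable and finitely many members of each `S ω` contribute:
the `finprod` is the eventually constant limit of finite products of simple functions. -/
theorem stubEntire_measurable_finprod_mem {Ω α K : Type*} [MeasurableSpace Ω] [Countable K] [Nonempty K]
    (U : K → α) {S : Ω → Set α} (hSU : ∀ ω, S ω ⊆ Set.range U) (hS : ∀ a, Measurable fun ω ↦ a ∈ S ω)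
    (g : α → ℂ) (hfin : ∀ ω, (S ω ∩ Function.mulSupport g).Finite) :
    Measurable fun ω ↦ ∏ᶠ a ∈ S ω, g a := by
  classical
  obtain ⟨e, he⟩ := exists_surjective_nat K
  have hmeas : ∀ n : ℕ, Measurable fun ω ↦
      ∏ u ∈ (Finset.range n).image (fun k ↦ U (e k)), (S ω).mulIndicator g u := fun n ↦
    Finset.measurable_prod _ fun u _ ↦ by
      simp only [Set.mulIndicator_apply]
      exact Measurable.ite (measurableSet_setOf.2 (hS u)) measurable_const measurable_const
  refine measurable_of_tendsto_metrizable hmeas (tendsto_pi_nhds.2 fun ω ↦ ?_)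
  -- every contributing member is some `U (e k)`; past the largest such `k` the product is the `finprod`
  have hidx : ∀ u ∈ S ω ∩ Function.mulSupport g, ∃ k, U (e k) = u := fun u hu ↦ by
    obtain ⟨k', hk'⟩ := hSU ω hu.1
    obtain ⟨k, rfl⟩ := he k'
    exact ⟨k, hk'⟩
  choose! idx hidx using hidx
  obtain ⟨m, hm⟩ := ((hfin ω).image idx).bddAbove
  refine tendsto_atTop_of_eventually_const (i₀ := m + 1) fun n hn ↦ ?_
  rw [finprod_mem_def]
  refine (finprod_eq_prod_of_mulSupport_subset _ fun u hu ↦ ?_).symm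
  rw [Set.mulSupport_mulIndicator] at hu
  rw [Finset.coe_image]
  refine ⟨idx u, ?_, hidx u hu⟩
  have h : idx u ≤ m := hm (Set.mem_image_of_mem idx hu)
  simp only [Finset.coe_range, Set.mem_Iio]
  omega

/-- **Measurability of the derivative in a parameter**: if every `F t` is measurable and every `F · ω` is
differentiable at `t₀`, then `ω ↦ deriv (F · ω) t₀` is measurable (limit of difference quotients). -/
theorem stubEntire_measurable_deriv {Ω : Type*} [MeasurableSpace Ω] {F : ℂ → Ω → ℂ}
    (hF : ∀ t, Measurable (F t)) (t₀ : ℂ) (hdiff : ∀ ω, DifferentiableAt ℂ (fun t ↦ F t ω) t₀) :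
    Measurable fun ω ↦ deriv (fun t ↦ F t ω) t₀ := by
  set u : ℕ → ℂ := fun n ↦ t₀ + ((n : ℂ))⁻¹ with hu
  have hu_lim : Tendsto u atTop (𝓝[≠] t₀) := by
    refine tendsto_nhdsWithin_iff.2 ⟨?_, ?_⟩
    · have h := (tendsto_inv_atTop_nhds_zero_nat (𝕜 := ℂ)).const_add t₀
      rwa [add_zero] at h
    · filter_upwards [Filter.eventually_ge_atTop 1] with n hn
      have hn' : (n : ℂ) ≠ 0 := Nat.cast_ne_zero.2 (by omega)
      simp [hu, hn']
  have hlim : ∀ ω, Tendsto (fun n ↦ slope (fun t ↦ F t ω) t₀ (u n)) atTop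
      (𝓝 (deriv (fun t ↦ F t ω) t₀)) := fun ω ↦ (hdiff ω).hasDerivAt.tendsto_slope.comp hu_lim
  refine measurable_of_tendsto_metrizable (fun n ↦ ?_) (tendsto_pi_nhds.2 hlim)
  simp only [slope, vsub_eq_sub]
  exact ((hF (u n)).sub (hF t₀)).const_smul ((u n - t₀)⁻¹)

/-! ## The factor `2cos(t a + π/3)` -/

/-- `cos(π/3) = 1/2` and `sin(π/3) = √3/2` in `ℂ`. -/
theorem stubEntire_cos_sin_pi_div_three : Complex.cos ((Real.pi : ℂ) / 3) = 1 / 2 ∧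
    Complex.sin ((Real.pi : ℂ) / 3) = ((Real.sqrt 3 : ℝ) : ℂ) / 2 := by
  have h : ((Real.pi / 3 : ℝ) : ℂ) = (Real.pi : ℂ) / 3 := by push_cast; ring
  refine ⟨?_, ?_⟩
  · rw [← h, ← Complex.ofReal_cos, Real.cos_pi_div_three]; push_cast; ring
  · rw [← h, ← Complex.ofReal_sin, Real.sin_pi_div_three]; push_cast; ring

/-- The twisted weight of a vanishing (complex) phase is `2cos(π/3) = 1`. -/
theorem stubEntire_factor_eq_one {t : ℂ} {a : ℝ} (h : t * (a : ℂ) = 0) :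
    2 * Complex.cos (t * (a : ℂ) + (Real.pi : ℂ) / 3) = 1 := by
  rw [h, zero_add, stubEntire_cos_sin_pi_div_three.1]
  norm_num

/-- `d/dt 2cos(t a + π/3) = −2 sin(t a + π/3) a`. -/
theorem stubEntire_hasDerivAt_factor (a : ℝ) (t : ℂ) :
    HasDerivAt (fun t : ℂ ↦ 2 * Complex.cos (t * (a : ℂ) + (Real.pi : ℂ) / 3))
      (-2 * Complex.sin (t * (a : ℂ) + (Real.pi : ℂ) / 3) * (a : ℂ)) t := by
  refine ((((hasDerivAt_mul_const (x := t) (a : ℂ)).add_const ((Real.pi : ℂ) / 3)).ccos).const_mul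
    (2 : ℂ)).congr_deriv ?_
  ring

/-- `|Im(t a + π/3)| ≤ ρ K + 2` for `‖t‖ ≤ ρ`, `|a| ≤ K`. -/
theorem stubEntire_abs_im_arg_le {a K ρ : ℝ} (ha : |a| ≤ K) {t : ℂ} (ht : ‖t‖ ≤ ρ) :
    |(t * (a : ℂ) + (Real.pi : ℂ) / 3).im| ≤ ρ * K + 2 := by
  refine (Complex.abs_im_le_norm _).trans ((norm_add_le _ _).trans (add_le_add ?_ ?_))
  · rw [norm_mul, Complex.norm_real, Real.norm_eq_abs]
    exact mul_le_mul ht ha (abs_nonneg a) ((norm_nonneg t).trans ht)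
  · have h : ((Real.pi / 3 : ℝ) : ℂ) = (Real.pi : ℂ) / 3 := by push_cast; ring
    rw [← h, Complex.norm_real, Real.norm_of_nonneg (by positivity)]
    linarith [Real.pi_le_four]

/-- `‖2cos(t a + π/3)‖ ≤ 2e^{ρK+2}` and `‖−2 sin(t a + π/3) a‖ ≤ 2e^{ρK+2} K` for `‖t‖ ≤ ρ`, `|a| ≤ K`. -/
theorem stubEntire_norm_factor_le {a K ρ : ℝ} (ha : |a| ≤ K) {t : ℂ} (ht : ‖t‖ ≤ ρ) :
    ‖2 * Complex.cos (t * (a : ℂ) + (Real.pi : ℂ) / 3)‖ ≤ 2 * Real.exp (ρ * K + 2) ∧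
    ‖-2 * Complex.sin (t * (a : ℂ) + (Real.pi : ℂ) / 3) * (a : ℂ)‖ ≤ 2 * Real.exp (ρ * K + 2) * K := by
  have hc : ‖Complex.cos (t * (a : ℂ) + (Real.pi : ℂ) / 3)‖ ≤ Real.exp (ρ * K + 2) :=
    (BesselInterp.norm_cos_le_exp_abs_im _).trans (Real.exp_le_exp.2 (stubEntire_abs_im_arg_le ha ht))
  have hs : ‖Complex.sin (t * (a : ℂ) + (Real.pi : ℂ) / 3)‖ ≤ Real.exp (ρ * K + 2) :=
    (BesselInterp.norm_sin_le_exp_abs_im _).trans (Real.exp_le_exp.2 (stubEntire_abs_im_arg_le ha ht))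
  rw [norm_mul, norm_mul, norm_mul, norm_neg, Complex.norm_two, Complex.norm_real, Real.norm_eq_abs]
  refine ⟨mul_le_mul_of_nonneg_left hc zero_le_two, ?_⟩
  rw [mul_assoc, mul_assoc]
  exact mul_le_mul_of_nonneg_left (mul_le_mul hs ha (abs_nonneg a) (Real.exp_pos _).le) zero_le_two

/-- `ℝ → ℂ` commutes with `finprod` over a set (an injective monoid hom; no finiteness needed). -/
theorem stubEntire_ofReal_finprod_mem {α : Type*} (g : α → ℝ) (s : Set α) :
    (((∏ᶠ a ∈ s, g a : ℝ)) : ℂ) = ∏ᶠ a ∈ s, ((g a : ℝ) : ℂ) := by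
  rw [finprod_mem_def, finprod_mem_def]
  refine ((Complex.ofRealHom : ℝ →+* ℂ).toMonoidHom.map_finprod_of_injective Complex.ofReal_injective
    (s.mulIndicator g)).trans (finprod_congr fun a ↦ ?_)
  exact map_mulIndicator _ s g a

/-! ## A loop family with finitely many loops meeting the ball -/

section Family

variable {f : ℂ → ℝ} {R C : ℝ}

/-- A loop whose complex factor `2cos(t θ_u + π/3)` differs from `1` has a non-zero phase. -/
theorem stubEntire_nestingPhase_ne_zero_of_ne_one {u : UnbasedLoop ℂ} {t : ℂ}
    (h : 2 * Complex.cos (t * ((u.nestingPhase f : ℝ) : ℂ) + (Real.pi : ℂ) / 3) ≠ 1) :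
    u.nestingPhase f ≠ 0 := by
  intro h0
  exact h (stubEntire_factor_eq_one (by rw [h0, Complex.ofReal_zero, mul_zero]))

/-- **The complex `finprod` is a finite product over the loops meeting the ball** (a `t`-independent
finite family). -/
theorem stubEntire_finprod_eq_prod (hR : ∀ z, R < ‖z‖ → f z = 0) (h0 : ∫ z, f z = 0)
    {L : Set (UnbasedLoop ℂ)} (hfin : {u ∈ L | (u.range ∩ closedBall (0 : ℂ) R).Nonempty}.Finite)
    (t : ℂ) :
    ∏ᶠ u ∈ L, 2 * Complex.cos (t * ((u.nestingPhase f : ℝ) : ℂ) + (Real.pi : ℂ) / 3) =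
      ∏ u ∈ hfin.toFinset, 2 * Complex.cos (t * ((u.nestingPhase f : ℝ) : ℂ) + (Real.pi : ℂ) / 3) := by
  refine finprod_mem_eq_prod_of_subset _ (fun u hu ↦ ?_) (fun u hu ↦ (hfin.mem_toFinset.1 hu).1)
  exact hfin.mem_toFinset.2 ⟨hu.1, sw_meets_of_nestingPhase_ne_zero hR h0
    (stubEntire_nestingPhase_ne_zero_of_ne_one hu.2)⟩

/-- **The complex-coupling integrand is measurable** over the loops of `siteLoopConfig δ ω` (index =
closed honeycomb walks, `loops_siteLoopConfig_subset_range`, `measurable_mem_loops_siteLoopConfig`). -/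
theorem stubEntire_measurable_integrand (hR : ∀ z, R < ‖z‖ → f z = 0) (h0 : ∫ z, f z = 0) {δ : ℝ}
    (hδ : 0 < δ) (t : ℂ) :
    Measurable fun ω : SiteConfig (Site 2) ↦ ∏ᶠ u ∈ (siteLoopConfig δ ω).loops,
      2 * Complex.cos (t * ((u.nestingPhase f : ℝ) : ℂ) + (Real.pi : ℂ) / 3) := by
  haveI := countable_sigma_hexLoop
  refine stubEntire_measurable_finprod_mem _ (loops_siteLoopConfig_subset_range δ)
    (measurable_mem_loops_siteLoopConfig δ) _ fun ω ↦ ?_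
  exact (ncard_loops_siteLoopConfig_meeting_le hδ R ω).1.subset fun u hu ↦
    ⟨hu.1, sw_meets_of_nestingPhase_ne_zero hR h0 (stubEntire_nestingPhase_ne_zero_of_ne_one hu.2)⟩

open Classical in
/-- **Product rule**: the integrand is differentiable in the coupling, with the Leibniz derivative. -/
theorem stubEntire_hasDerivAt_finprod (hR : ∀ z, R < ‖z‖ → f z = 0) (h0 : ∫ z, f z = 0)
    {L : Set (UnbasedLoop ℂ)} (hfin : {u ∈ L | (u.range ∩ closedBall (0 : ℂ) R).Nonempty}.Finite)
    (t : ℂ) :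
    HasDerivAt (fun t : ℂ ↦ ∏ᶠ u ∈ L, 2 * Complex.cos (t * ((u.nestingPhase f : ℝ) : ℂ) + (Real.pi : ℂ) / 3))
      (∑ u ∈ hfin.toFinset,
        (∏ v ∈ hfin.toFinset.erase u, 2 * Complex.cos (t * ((v.nestingPhase f : ℝ) : ℂ) + (Real.pi : ℂ) / 3)) *
          (-2 * Complex.sin (t * ((u.nestingPhase f : ℝ) : ℂ) + (Real.pi : ℂ) / 3) *
            ((u.nestingPhase f : ℝ) : ℂ))) t := by
  have h := HasDerivAt.fun_finsetProd (u := hfin.toFinset) (x := t)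
    (f := fun u t ↦ 2 * Complex.cos (t * ((u.nestingPhase f : ℝ) : ℂ) + (Real.pi : ℂ) / 3))
    (f' := fun u ↦ -2 * Complex.sin (t * ((u.nestingPhase f : ℝ) : ℂ) + (Real.pi : ℂ) / 3) *
      ((u.nestingPhase f : ℝ) : ℂ))
    fun u _ ↦ stubEntire_hasDerivAt_factor (u.nestingPhase f) t
  simp only [smul_eq_mul] at h
  exact h.congr_of_eventuallyEq (Eventually.of_forall fun s ↦ stubEntire_finprod_eq_prod hR h0 hfin s)

/-- **The derivative at zero coupling**: `∂_t|_{t=0} ∏_u 2cos(t θ_u + π/3) = −√3 Σ_u θ_u`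
(`2cos(π/3) = 1`, `−2sin(π/3) = −√3`; the finsum is a finite sum over the loops meeting the ball). -/
theorem stubEntire_deriv_zero (hR : ∀ z, R < ‖z‖ → f z = 0) (h0 : ∫ z, f z = 0)
    {L : Set (UnbasedLoop ℂ)} (hfin : {u ∈ L | (u.range ∩ closedBall (0 : ℂ) R).Nonempty}.Finite) :
    deriv (fun t : ℂ ↦ ∏ᶠ u ∈ L, 2 * Complex.cos (t * ((u.nestingPhase f : ℝ) : ℂ) + (Real.pi : ℂ) / 3)) 0 =
      -((Real.sqrt 3 : ℝ) : ℂ) * ((∑ᶠ u ∈ L, u.nestingPhase f : ℝ) : ℂ) := by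
  classical
  have h1 : 2 * Complex.cos ((Real.pi : ℂ) / 3) = 1 := by
    rw [stubEntire_cos_sin_pi_div_three.1]; norm_num
  have h2 : ∑ᶠ u ∈ L, u.nestingPhase f = ∑ u ∈ hfin.toFinset, u.nestingPhase f :=
    finsum_mem_eq_sum_of_subset _
      (fun u hu ↦ hfin.mem_toFinset.2 ⟨hu.1, sw_meets_of_nestingPhase_ne_zero hR h0 hu.2⟩)
      (fun u hu ↦ (hfin.mem_toFinset.1 hu).1)
  rw [(stubEntire_hasDerivAt_finprod hR h0 hfin 0).deriv, h2]
  simp only [zero_mul, zero_add, h1, Finset.prod_const_one, one_mul, stubEntire_cos_sin_pi_div_three.2]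
  rw [Complex.ofReal_sum, Finset.mul_sum]
  exact Finset.sum_congr rfl fun u _ ↦ by ring

/-- A finite product of twisted weights over at most `N` loops has norm `≤ (2e^{ρK+2})^N` on `‖t‖ ≤ ρ`,
`K = C · Leb(B̄(0,R))` (`abs_nestingPhase_le_mul_volume_closedBall`; each factor has norm `≤ 2e^{ρK+2}`,
a number `≥ 1`). -/
theorem stubEntire_norm_prod_factor_le (hC : ∀ z, |f z| ≤ C) (hR : ∀ z, R < ‖z‖ → f z = 0)
    (S : Finset (UnbasedLoop ℂ)) {N : ℕ} (hN : S.card ≤ N) {ρ : ℝ} {t : ℂ} (ht : ‖t‖ ≤ ρ) :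
    ‖∏ v ∈ S, 2 * Complex.cos (t * ((v.nestingPhase f : ℝ) : ℂ) + (Real.pi : ℂ) / 3)‖ ≤
      (2 * Real.exp (ρ * (C * volume.real (closedBall (0 : ℂ) R)) + 2)) ^ N := by
  have hK0 : 0 ≤ C * volume.real (closedBall (0 : ℂ) R) :=
    mul_nonneg (nonneg_of_abs_le hC) measureReal_nonneg
  have hρ : 0 ≤ ρ := (norm_nonneg t).trans ht
  have hB1 : 1 ≤ 2 * Real.exp (ρ * (C * volume.real (closedBall (0 : ℂ) R)) + 2) := by
    nlinarith [Real.add_one_le_exp (ρ * (C * volume.real (closedBall (0 : ℂ) R)) + 2),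
      mul_nonneg hρ hK0]
  refine (Finset.norm_prod_le _ _).trans ((Finset.prod_le_prod (fun _ _ ↦ norm_nonneg _) fun v _ ↦
    (stubEntire_norm_factor_le (abs_nestingPhase_le_mul_volume_closedBall hC hR v) ht).1).trans ?_)
  rw [Finset.prod_const]
  exact pow_le_pow_right₀ hB1 hN

/-- **Uniform bounds on the integrand and on its `t`-derivative** on `‖t‖ ≤ ρ`: `(2e^{ρK+2})^N` and
`N · (2e^{ρK+2})^N · 2e^{ρK+2} K`, `N ≥` the number of loops meeting the ball. -/
theorem stubEntire_norm_finprod_le (hC : ∀ z, |f z| ≤ C) (hR : ∀ z, R < ‖z‖ → f z = 0)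
    (h0 : ∫ z, f z = 0) {L : Set (UnbasedLoop ℂ)}
    (hfin : {u ∈ L | (u.range ∩ closedBall (0 : ℂ) R).Nonempty}.Finite) {N : ℕ}
    (hN : {u ∈ L | (u.range ∩ closedBall (0 : ℂ) R).Nonempty}.ncard ≤ N) {ρ : ℝ} {t : ℂ}
    (ht : ‖t‖ ≤ ρ) :
    ‖∏ᶠ u ∈ L, 2 * Complex.cos (t * ((u.nestingPhase f : ℝ) : ℂ) + (Real.pi : ℂ) / 3)‖ ≤
      (2 * Real.exp (ρ * (C * volume.real (closedBall (0 : ℂ) R)) + 2)) ^ N ∧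
    ‖deriv (fun t : ℂ ↦ ∏ᶠ u ∈ L, 2 * Complex.cos (t * ((u.nestingPhase f : ℝ) : ℂ) + (Real.pi : ℂ) / 3)) t‖ ≤
      N * ((2 * Real.exp (ρ * (C * volume.real (closedBall (0 : ℂ) R)) + 2)) ^ N *
        (2 * Real.exp (ρ * (C * volume.real (closedBall (0 : ℂ) R)) + 2) *
          (C * volume.real (closedBall (0 : ℂ) R)))) := by
  classical
  set K : ℝ := C * volume.real (closedBall (0 : ℂ) R) with hK
  set B : ℝ := 2 * Real.exp (ρ * K + 2) with hB
  have hcard : hfin.toFinset.card ≤ N := by rwa [← Set.ncard_eq_toFinset_card _ hfin]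
  have hK0 : 0 ≤ K := mul_nonneg (nonneg_of_abs_le hC) measureReal_nonneg
  refine ⟨?_, ?_⟩
  · rw [stubEntire_finprod_eq_prod hR h0 hfin t]
    exact stubEntire_norm_prod_factor_le hC hR _ hcard ht
  rw [(stubEntire_hasDerivAt_finprod hR h0 hfin t).deriv]
  refine (norm_sum_le_of_le (n := fun _ ↦ B ^ N * (B * K)) _ fun u _ ↦ ?_).trans ?_
  · rw [norm_mul]
    exact mul_le_mul (stubEntire_norm_prod_factor_le hC hR _ (Finset.card_erase_le.trans hcard) ht)
      (stubEntire_norm_factor_le (abs_nestingPhase_le_mul_volume_closedBall hC hR u) ht).2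
      (norm_nonneg _) (by positivity)
  · rw [Finset.sum_const, nsmul_eq_mul]
    exact mul_le_mul_of_nonneg_right (Nat.cast_le.2 hcard) (by positivity)

/-- **At a real coupling the complex integrand is the real nesting weight of `t f`**
(`nestingPhase (t·f) = t · nestingPhase f` by `integral_const_mul`, `Complex.ofReal_cos`). -/
theorem stubEntire_finprod_ofReal (t : ℝ) (c : LoopConfig ℂ) :
    ∏ᶠ u ∈ c.loops, 2 * Complex.cos ((t : ℂ) * ((u.nestingPhase f : ℝ) : ℂ) + (Real.pi : ℂ) / 3) =
      ((c.nestingWeight (fun z ↦ t * f z) : ℝ) : ℂ) := by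
  have h : ∀ u : UnbasedLoop ℂ, u.nestingPhase (fun z ↦ t * f z) = t * u.nestingPhase f := fun u ↦ by
    simp only [UnbasedLoop.nestingPhase]
    exact integral_const_mul t f
  simp only [LoopConfig.nestingWeight, UnbasedLoop.nestingFactor, h, stubEntire_ofReal_finprod_mem]
  refine finprod_mem_congr rfl fun u _ ↦ ?_
  push_cast
  ring_nf

end Family

/-! ## The registered stub -/

/-- **Stub E (`stub_entire`) · fixed-mesh differentiation package.**  For every admissible `f` and mesh
`δ > 0`: `Φ_δ(t) = E_{1/2}[∏_u 2cos(t·θ_u(f) + π/3)]` is an entire function of the coupling `t`;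
`Φ_δ(0) = 1`; `Φ_δ'(0) = −√3 · E[Σ_u ∫_{W(u,·)≠0} f]`; and `Φ_δ(t) = Λ^𝕋_δ(t f)` at real couplings.
Finitely many loops meet `B̄(0,R)` at fixed mesh, so the integrand is, for every `ω`, a finite product of
entire factors, dominated together with its `t`-derivative uniformly in `ω` on bounded `t`-sets;
differentiate under the integral sign (`hasDerivAt_integral_of_dominated_loc_of_deriv_le`). -/
theorem stub_entire : ∀ (f : ℂ → ℝ) (R C : ℝ), Measurable f → (∀ z, |f z| ≤ C) →
    (∀ z, R < ‖z‖ → f z = 0) → ∫ z, f z = 0 → ∀ δ : ℝ, 0 < δ →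
    Differentiable ℂ (fun t : ℂ ↦ ∫ ω, (∏ᶠ u ∈ (siteLoopConfig δ ω).loops,
      2 * Complex.cos (t * ((u.nestingPhase f : ℝ) : ℂ) + (Real.pi : ℂ) / 3)) ∂(triSitePercolation half)) ∧
    (fun t : ℂ ↦ ∫ ω, (∏ᶠ u ∈ (siteLoopConfig δ ω).loops,
      2 * Complex.cos (t * ((u.nestingPhase f : ℝ) : ℂ) + (Real.pi : ℂ) / 3)) ∂(triSitePercolation half)) 0 = 1 ∧
    deriv (fun t : ℂ ↦ ∫ ω, (∏ᶠ u ∈ (siteLoopConfig δ ω).loops,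
      2 * Complex.cos (t * ((u.nestingPhase f : ℝ) : ℂ) + (Real.pi : ℂ) / 3)) ∂(triSitePercolation half)) 0 =
      -((Real.sqrt 3 : ℝ) : ℂ) * ((∫ ω, (∑ᶠ u ∈ (siteLoopConfig δ ω).loops, ∫ z in {z : ℂ | u.wind z ≠ 0}, f z)
        ∂(triSitePercolation half) : ℝ) : ℂ) ∧
    (∀ t : ℝ, (fun t : ℂ ↦ ∫ ω, (∏ᶠ u ∈ (siteLoopConfig δ ω).loops,
      2 * Complex.cos (t * ((u.nestingPhase f : ℝ) : ℂ) + (Real.pi : ℂ) / 3)) ∂(triSitePercolation half)) (t : ℂ) =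
      ((truncNestingTransform (triSitePercolation half) (siteLoopConfig δ) (fun z ↦ t * f z) 0 : ℝ) : ℂ)) := by
  intro f R C _ hC hR h0 δ hδ
  set P : Measure (SiteConfig (Site 2)) := triSitePercolation half with hP
  set F : ℂ → SiteConfig (Site 2) → ℂ := fun t ω ↦ ∏ᶠ u ∈ (siteLoopConfig δ ω).loops,
    2 * Complex.cos (t * ((u.nestingPhase f : ℝ) : ℂ) + (Real.pi : ℂ) / 3) with hFdef
  set N : ℕ := (finite_setOf_norm_hexCenter_le hδ (R + 2 * δ)).toFinset.card with hNdef
  set K : ℝ := C * volume.real (closedBall (0 : ℂ) R) with hKdef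
  have hfin := fun ω : SiteConfig (Site 2) ↦ (ncard_loops_siteLoopConfig_meeting_le hδ R ω).1
  have hN := fun ω : SiteConfig (Site 2) ↦ (ncard_loops_siteLoopConfig_meeting_le hδ R ω).2
  -- measurability, differentiability and the uniform bounds, configuration by configuration
  have hmeas : ∀ t, Measurable (F t) := fun t ↦ stubEntire_measurable_integrand hR h0 hδ t
  have hdiff : ∀ ω t, DifferentiableAt ℂ (fun t ↦ F t ω) t :=
    fun ω t ↦ (stubEntire_hasDerivAt_finprod hR h0 (hfin ω) t).differentiableAt
  have hbd : ∀ (ρ : ℝ) ω (t : ℂ), ‖t‖ ≤ ρ → ‖F t ω‖ ≤ (2 * Real.exp (ρ * K + 2)) ^ N ∧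
      ‖deriv (fun t ↦ F t ω) t‖ ≤ N * ((2 * Real.exp (ρ * K + 2)) ^ N * (2 * Real.exp (ρ * K + 2) * K)) :=
    fun ρ ω t ht ↦ stubEntire_norm_finprod_le hC hR h0 (hfin ω) (hN ω) ht
  have hint : ∀ t, Integrable (F t) P := fun t ↦
    Integrable.mono' (integrable_const ((2 * Real.exp (‖t‖ * K + 2)) ^ N))
      (hmeas t).aestronglyMeasurable (Eventually.of_forall fun ω ↦ (hbd ‖t‖ ω t le_rfl).1)
  -- differentiation under the integral sign at every coupling
  have key : ∀ t₀ : ℂ, HasDerivAt (fun t ↦ ∫ ω, F t ω ∂P) (∫ ω, deriv (fun t ↦ F t ω) t₀ ∂P) t₀ := by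
    intro t₀
    refine (hasDerivAt_integral_of_dominated_loc_of_deriv_le (F' := fun t ω ↦ deriv (fun t ↦ F t ω) t)
      (bound := fun _ ↦ N * ((2 * Real.exp ((‖t₀‖ + 1) * K + 2)) ^ N *
        (2 * Real.exp ((‖t₀‖ + 1) * K + 2) * K)))
      (ball_mem_nhds t₀ one_pos) (Eventually.of_forall fun t ↦ (hmeas t).aestronglyMeasurable) (hint t₀)
      (stubEntire_measurable_deriv hmeas t₀ fun ω ↦ hdiff ω t₀).aestronglyMeasurable
      (Eventually.of_forall fun ω t ht ↦ (hbd _ ω t (norm_lt_of_mem_ball ht).le).2) (integrable_const _)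
      (Eventually.of_forall fun ω t _ ↦ (hdiff ω t).hasDerivAt)).2
  refine ⟨fun t₀ ↦ (key t₀).differentiableAt, ?_, ?_, fun t ↦ ?_⟩
  · -- order 0: every factor is `2cos(π/3) = 1`
    change ∫ ω, F 0 ω ∂P = 1
    have h1 : ∀ ω, F 0 ω = 1 := fun ω ↦
      finprod_mem_eq_one_of_forall_eq_one fun u _ ↦ stubEntire_factor_eq_one (zero_mul _)
    simp [h1]
  · -- order 1: `−√3 Σ_u θ_u` under the integral
    change deriv (fun t ↦ ∫ ω, F t ω ∂P) 0 = _
    rw [(key 0).deriv]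
    have h1 : ∀ ω, deriv (fun t ↦ F t ω) 0 =
        -((Real.sqrt 3 : ℝ) : ℂ) * ((∑ᶠ u ∈ (siteLoopConfig δ ω).loops, u.nestingPhase f : ℝ) : ℂ) :=
      fun ω ↦ stubEntire_deriv_zero hR h0 (hfin ω)
    simp_rw [h1]
    rw [integral_const_mul, integral_complex_ofReal]
    rfl
  · -- real coupling
    change ∫ ω, F (t : ℂ) ω ∂P = _
    rw [truncNestingTransform_zero, ← integral_complex_ofReal]
    exact integral_congr_ae (Eventually.of_forall fun ω ↦ stubEntire_finprod_ofReal t _)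

end Summit.CriticalPhenomena.CardyFormulaZ2.Cruxes.MagicFormulaT.LineSketch

end
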